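import Literature.IUT.HodgeArakelov.TemperedThetaMonoids
import Literature.AnabelianGeometry.AbsoluteAnabelian.MLFGaloisPairs

/-!
# [IUTchII] §3, Proposition 3.4 (Group-theoretic Theta Monoids): the output pairs of the functorial
# algorithm `Π_v ↦ (Π_X(M^Θ_*(Π_v)) ↷ Ψ_env(M^Θ_*(Π_v)))` and their functoriality

Mochizuki, *Inter-universal Teichmüller theory II*, §3, kurims manuscript (Dec. 2020) pp. 91–93
[claim: Mochizuki2012, status: disputed] (IUTchII §3 Prop 3.4, kurims pp.91-93). Record-only typing under the
claim key `Mochizuki2012` (D-0012, disputed); nothing here takes a side on [IUTchIII] Cor 3.12.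

`TemperedThetaMonoids.lean` (abc-iut-L6-t2) records the INPUT of Prop 3.1 as the value-level structure
`TemperedThetaMonoids.ThetaEnvData P` (ambient module `lim_J H¹(Π_Ÿ(M^Θ_*)|_J, Π_μ(M^Θ_*))` with the
conjugation action of `Π_X(M^Θ_*)`, `M^×_TM`, `M_TM`, `θ^ι_env`, `∞θ^ι_env`) and DEFINES the theta monoids
`Ψ^ι_env`, `∞Ψ^ι_env`, `Ψ_cns`; the radiality assertions of Prop 3.4 are the SLOT-ONLY record
`TemperedThetaMonoids.RadialityStatements`. The sub-DAG of [IUTchIII] Prop 2.1 (abc-iut-L6-t14,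
`SUBDAG-IUTchIII-Prop-21`, row `Prop34_algorithm`) asks for a stand-alone declaration of the OUTPUT of the
functorial algorithm of Prop 3.4 (i) — the pairs "topological group acting on an [ind-topological] monoid"
  `Π_X(M^Θ_*(Π_v)) ↷ Ψ^ι_env(M^Θ_*(Π_v))`, `Π_X(M^Θ_*(Π_v)) ↷ ∞Ψ^ι_env(M^Θ_*(Π_v))`, `G_v(M^Θ_*(Π_v)) ↷ Ψ^ι_env(M^Θ_*(Π_v))^×`
(first and second displays of Prop 3.4 (i), p. 91) and of "the left-hand square in each diagram arises from the
functoriality of the algorithms involved, relative to isomorphisms of projective systems of mono-theta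
environments" (p. 91 l. −8, p. 92 l. −12). This file supplies exactly that, in the tree's vocabulary:
* `ThetaEnvData.Iso E E'` — an isomorphism of theta-environment data along a group isomorphism
  `φ : Π ⥲ Π'` (what an isomorphism `M^Θ_*(Π_v) ⥲ M^Θ_*(†F_v)` of projective systems induces on the Prop 3.1
  data), with `refl/symm/trans`; the induced identities `Iso.map_thetaMonoid`, `Iso.map_inftyThetaMonoid`,
  `Iso.map_constantMonoid`, `Iso.isConjStable_map` are PROVED (bookkeeping) — these are the left-hand squares;
* `ThetaEnvData.conjRestrict` — the conjugation action restricted to a stable submonoid, and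
  `ThetaEnvData.conjQuot` — its factorisation through a quotient `Π_X ↠ G_v` acting trivially (the pair
  `G_v(M^Θ_*) ↷ Ψ^×` of the second display);
* `ThetaEnvData.splitThetaPair`, `ThetaEnvData.constantPair` — the output pairs as `GaloisMonoidPair`s
  ([AbsTopIII] Def 3.1 (ii), `Literature.AnabelianGeometry.AbsoluteAnabelian.GaloisMonoidPair`, the shape in
  which [IUTchII] Ex 1.8 / Rmk 1.11.1 and [IUTchIII] Prop 2.1 consume "MLF-Galois TM-pairs"), GIVEN the topology
  of `Π` and the openness of point stabilisers (continuity data the value-level record does not carry —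
  hypotheses, not assertions), and `Iso.splitThetaPairIso`, `Iso.constantPairIso` — the induced isomorphisms of
  pairs (PROVED compatibility with the actions).

What is NOT here: the multiradiality / uniradiality CONTENT of Prop 3.4 (i)/(ii) (slots
`RadialityStatements.splitTheta_multiradial/constant_uniradial`, whose REAL form is t1's `RadialEnvironments`
formalism), and the instantiation of `ThetaEnvData` from abc-iut-L6-t1's `MonoThetaProjective.ThetaEnvData` /
`ConstantMultipleRigidity.ThetaEvaluation` (bridge owed; it needs a `Π`-action on t1's `CohomologySystem`).
-/
namespace Literature.IUT.HodgeArakelov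

namespace TemperedThetaMonoids

open Literature.AnabelianGeometry.AbsoluteAnabelian (GaloisMonoidPair)

universe u v

namespace ThetaEnvData

variable {P : Type u} [Group P] {P' : Type u} [Group P'] {P'' : Type u} [Group P'']

/-! ### 1. Isomorphisms of theta-environment data and the functoriality squares of Prop 3.4 -/

/-- An **isomorphism of theta-environment data** `E ⥲ E'` along an isomorphism of groups `φ : Π ⥲ Π'`: an
isomorphism `e` of the ambient modules intertwining the conjugation actions along `φ`, carrying `M^×_TM`,
`M_TM` onto each other, and a bijection of the index sets of inversion automorphisms along which `e` carries
`θ^ι_env`, `∞θ^ι_env` onto `θ^{ι'}_env`, `∞θ^{ι'}_env`. This is what "each isomorphism of projective systems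
of mono-theta environments `M^Θ_*(Π_v) ⥲ M^Θ_*(†F_v)`" induces on the data of Prop 3.1 ([IUTchII] Prop 3.4
(i), (ii) p. 91–92: "compatible collections of isomorphisms … the left-hand square in each diagram arises
from the functoriality of the algorithms involved"). [cite: Mochizuki2012, Prop 3.4 (i) p.91] -/
structure Iso (E : ThetaEnvData.{u, v} P) (E' : ThetaEnvData.{u, v} P') where
  /-- `Π_X(M^Θ_*(Π_v)) ⥲ Π_X(M^Θ_*(†F_v))` (upper horizontal arrow) -/
  phi : P ≃* P'
  /-- the isomorphism of ambient modules `lim_J H¹(…) ⥲ lim_J H¹(…)` -/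
  e : E.H ≃* E'.H
  /-- the induced bijection of inversion automorphisms `ι ↦ ι'` -/
  iota : E.Iota ≃ E'.Iota
  /-- `e` intertwines the conjugation actions along `φ` -/
  map_conj : ∀ (g : P) (x : E.H), e (E.conj g x) = E'.conj (phi g) (e x)
  /-- `e(M^×_TM) = M^×_TM` -/
  map_units : E.units.map (e : E.H →* E'.H) = E'.units
  /-- `e(M_TM) = M_TM` -/
  map_constants : E.constants.map e = E'.constants
  /-- `e(θ^ι_env) = θ^{ι'}_env` -/
  image_thetaEnv : ∀ ι, e '' E.thetaEnv ι = E'.thetaEnv (iota ι)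
  /-- `e(∞θ^ι_env) = ∞θ^{ι'}_env` -/
  image_inftyThetaEnv : ∀ ι, e '' E.inftyThetaEnv ι = E'.inftyThetaEnv (iota ι)

namespace Iso

variable {E : ThetaEnvData.{u, v} P} {E' : ThetaEnvData.{u, v} P'} {E'' : ThetaEnvData.{u, v} P''}

/-- `e(M^×_TM) = M^×_TM` at the level of submonoids (bookkeeping). [cite: Mochizuki2012, Prop 3.4 (i) p.91] -/
theorem map_units_toSubmonoid (I : Iso E E') : E.units.toSubmonoid.map I.e = E'.units.toSubmonoid := by
  rw [← I.map_units]
  exact SetLike.coe_injective (by simp [Submonoid.coe_map])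

/-- **Left-hand square of the first display of Prop 3.4 (i)** (p. 91), PROVED (bookkeeping): an isomorphism
of theta-environment data carries `Ψ^ι_env = M^×_TM · (θ^ι_env)^ℕ` onto `Ψ^{ι'}_env`.
[cite: Mochizuki2012, Prop 3.4 (i) p.91] -/
theorem map_thetaMonoid (I : Iso E E') (ι : E.Iota) :
    (E.thetaMonoid ι).map I.e = E'.thetaMonoid (I.iota ι) := by
  simp only [thetaMonoid, splitMonoid, Submonoid.map_sup, MonoidHom.map_mclosure, I.image_thetaEnv,
    I.map_units_toSubmonoid]

/-- **Left-hand square of the first display of Prop 3.4 (i)**, `∞`-version (p. 91), PROVED (bookkeeping):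
`e(∞Ψ^ι_env) = ∞Ψ^{ι'}_env`. [cite: Mochizuki2012, Prop 3.4 (i) p.91] -/
theorem map_inftyThetaMonoid (I : Iso E E') (ι : E.Iota) :
    (E.inftyThetaMonoid ι).map I.e = E'.inftyThetaMonoid (I.iota ι) := by
  simp only [inftyThetaMonoid, splitMonoid, Submonoid.map_sup, MonoidHom.map_mclosure, I.image_inftyThetaEnv,
    I.map_units_toSubmonoid]

/-- The collections `Ψ_env = {Ψ^ι_env}_ι`, `∞Ψ_env` are carried onto each other, index by index (p. 91,
"compatible collections of isomorphisms"). [cite: Mochizuki2012, Prop 3.4 (i) p.91] -/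
theorem map_thetaMonoidCollection (I : Iso E E') (ι : E.Iota) :
    ((E.thetaMonoidCollection ι).1.map I.e, (E.thetaMonoidCollection ι).2.map I.e) =
      E'.thetaMonoidCollection (I.iota ι) := by
  simp only [thetaMonoidCollection, I.map_thetaMonoid, I.map_inftyThetaMonoid]

/-- **Left-hand square of the first display of Prop 3.4 (ii)** (p. 92), PROVED (bookkeeping): an
isomorphism of theta-environment data carries `Ψ_cns = M_TM` onto `Ψ_cns`. [cite: Mochizuki2012, Prop 3.4 (ii) p.92] -/
theorem map_constantMonoid (I : Iso E E') : E.constantMonoid.map I.e = E'.constantMonoid := by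
  simp only [constantMonoid, I.map_constants]

/-- Conjugation-stability is transported along an isomorphism of theta-environment data (the actions are
intertwined). [cite: Mochizuki2012, Prop 3.4 (i) p.91] -/
theorem isConjStable_map (I : Iso E E') {S : Submonoid E.H} (hS : E.IsConjStable S) :
    E'.IsConjStable (S.map I.e) := by
  intro g' y hy
  obtain ⟨x, hx, rfl⟩ := Submonoid.mem_map.1 hy
  refine Submonoid.mem_map.2 ⟨E.conj (I.phi.symm g') x, hS _ x hx, ?_⟩
  rw [I.map_conj, MulEquiv.apply_symm_apply]

variable (E) in
/-- The identity isomorphism of theta-environment data. [cite: Mochizuki2012, Prop 3.4 (i) p.91] -/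
def refl : Iso E E where
  phi := MulEquiv.refl P
  e := MulEquiv.refl E.H
  iota := Equiv.refl E.Iota
  map_conj _ _ := rfl
  map_units := by simp
  map_constants := SetLike.coe_injective (by simp [Submonoid.coe_map])
  image_thetaEnv ι := by simp
  image_inftyThetaEnv ι := by simp

/-- The inverse of an isomorphism of theta-environment data. [cite: Mochizuki2012, Prop 3.4 (i) p.91] -/
def symm (I : Iso E E') : Iso E' E where
  phi := I.phi.symm
  e := I.e.symm
  iota := I.iota.symm
  map_conj g' y := I.e.injective (by rw [I.map_conj]; simp)
  map_units := by
    rw [← I.map_units, Subgroup.map_map]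
    convert Subgroup.map_id E.units
    ext x
    simp
  map_constants := by
    rw [← I.map_constants]
    exact SetLike.coe_injective (by simp [Submonoid.coe_map, Set.image_image])
  image_thetaEnv ι' := by
    rw [← Set.image_id (E.thetaEnv (I.iota.symm ι')), ← I.e.symm_comp_self, Set.image_comp, I.image_thetaEnv,
      Equiv.apply_symm_apply]
  image_inftyThetaEnv ι' := by
    rw [← Set.image_id (E.inftyThetaEnv (I.iota.symm ι')), ← I.e.symm_comp_self, Set.image_comp,
      I.image_inftyThetaEnv, Equiv.apply_symm_apply]

/-- Composition of isomorphisms of theta-environment data. [cite: Mochizuki2012, Prop 3.4 (i) p.91] -/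
def trans (I : Iso E E') (I' : Iso E' E'') : Iso E E'' where
  phi := I.phi.trans I'.phi
  e := I.e.trans I'.e
  iota := I.iota.trans I'.iota
  map_conj g x := by simp [I.map_conj, I'.map_conj]
  map_units := by
    rw [← I'.map_units, ← I.map_units, Subgroup.map_map]
    rfl
  map_constants := by
    rw [← I'.map_constants, ← I.map_constants]
    exact SetLike.coe_injective (by simp [Submonoid.coe_map, Set.image_image])
  image_thetaEnv ι := by
    rw [Equiv.trans_apply, ← I'.image_thetaEnv, ← I.image_thetaEnv, Set.image_image]
    rfl
  image_inftyThetaEnv ι := by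
    rw [Equiv.trans_apply, ← I'.image_inftyThetaEnv, ← I.image_inftyThetaEnv, Set.image_image]
    rfl

/-- The isomorphism of (sub)monoids `S ⥲ e(S) = S'` induced by an isomorphism of theta-environment data on a
submonoid it carries onto `S'` (the lower/middle horizontal arrows of the displays of Prop 3.4, restricted
to the left-hand squares). [cite: Mochizuki2012, Prop 3.4 (i) p.91] -/
def restrict (I : Iso E E') (S : Submonoid E.H) (S' : Submonoid E'.H) (h : S.map I.e = S') : S ≃* S' where
  toFun x := ⟨I.e x, h ▸ Submonoid.mem_map_of_mem I.e x.2⟩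
  invFun y := ⟨I.e.symm y, by
    obtain ⟨x, hx, hxy⟩ := Submonoid.mem_map.1 (h.symm ▸ y.2 : (y : E'.H) ∈ S.map I.e)
    rw [← hxy, MulEquiv.symm_apply_apply]
    exact hx⟩
  left_inv x := Subtype.ext (I.e.symm_apply_apply x)
  right_inv y := Subtype.ext (I.e.apply_symm_apply y)
  map_mul' x y := Subtype.ext (by simp)

/-- Underlying map of `restrict` (bookkeeping). [cite: Mochizuki2012, Prop 3.4 (i) p.91] -/
@[simp] theorem coe_restrict_apply (I : Iso E E') (S : Submonoid E.H) (S' : Submonoid E'.H) (h : S.map I.e = S')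
    (x : S) : (I.restrict S S' h x : E'.H) = I.e x := rfl

/-- `Ψ^ι_env(M^Θ_*(Π_v)) ⥲ Ψ^{ι'}_env(M^Θ_*(†F_v))` — the middle horizontal arrow of the first display of Prop 3.4 (i),
left-hand square. [cite: Mochizuki2012, Prop 3.4 (i) p.91] -/
def thetaMonoidIso (I : Iso E E') (ι : E.Iota) : E.thetaMonoid ι ≃* E'.thetaMonoid (I.iota ι) :=
  I.restrict _ _ (I.map_thetaMonoid ι)

/-- `∞Ψ^ι_env(M^Θ_*(Π_v)) ⥲ ∞Ψ^{ι'}_env(M^Θ_*(†F_v))` (first display of Prop 3.4 (i), `∞`-row).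
[cite: Mochizuki2012, Prop 3.4 (i) p.91] -/
def inftyThetaMonoidIso (I : Iso E E') (ι : E.Iota) : E.inftyThetaMonoid ι ≃* E'.inftyThetaMonoid (I.iota ι) :=
  I.restrict _ _ (I.map_inftyThetaMonoid ι)

/-- `Ψ_cns(M^Θ_*(Π_v)) ⥲ Ψ_cns(M^Θ_*(†F_v))` — the lower horizontal arrow of the first display of Prop 3.4 (ii),
left-hand square. [cite: Mochizuki2012, Prop 3.4 (ii) p.92] -/
def constantMonoidIso (I : Iso E E') : E.constantMonoid ≃* E'.constantMonoid :=
  I.restrict _ _ I.map_constantMonoid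

/-- The two isomorphisms are compatible with the inclusions `Ψ^ι_env ⊆ ∞Ψ^ι_env` ("compatible [in the evident
sense] collections of isomorphisms", p. 91). [cite: Mochizuki2012, Prop 3.4 (i) p.91] -/
theorem inftyThetaMonoidIso_inclusion (I : Iso E E') (ι : E.Iota) (x : E.thetaMonoid ι) :
    (I.inftyThetaMonoidIso ι (Submonoid.inclusion (E.thetaMonoid_le_infty ι) x) : E'.H) =
      Submonoid.inclusion (E'.thetaMonoid_le_infty (I.iota ι)) (I.thetaMonoidIso ι x) := rfl

end Iso

/-! ### 2. The conjugation action on a stable submonoid; factorisation through `Π_X ↠ G_v` -/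

section Action

variable (E : ThetaEnvData.{u, v} P)

/-- The conjugation action of `Π_X(M^Θ_*)` restricted to a conjugation-stable submonoid `S` of the ambient
module, as a homomorphism `Π_X(M^Θ_*) → Aut(S)` ("equipped with their natural conjugation actions", Prop 3.1
(i) p. 87; the vertical arrows `↷` of the displays of Prop 3.4). [cite: Mochizuki2012, Prop 3.4 (i) p.91] -/
def conjRestrict (S : Submonoid E.H) (hS : E.IsConjStable S) : P →* MulAut S where
  toFun g :=
    { toFun := fun x => ⟨E.conj g x, hS g x x.2⟩
      invFun := fun x => ⟨E.conj g⁻¹ x, hS g⁻¹ x x.2⟩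
      left_inv := fun x => Subtype.ext (by
        show E.conj g⁻¹ (E.conj g x) = x
        rw [← MulAut.mul_apply, ← map_mul, inv_mul_cancel, map_one, MulAut.one_apply])
      right_inv := fun x => Subtype.ext (by
        show E.conj g (E.conj g⁻¹ x) = x
        rw [← MulAut.mul_apply, ← map_mul, mul_inv_cancel, map_one, MulAut.one_apply])
      map_mul' := fun x y => Subtype.ext (by simp) }
  map_one' := MulEquiv.ext fun x => Subtype.ext (by simp)
  map_mul' g h := MulEquiv.ext fun x => Subtype.ext (by simp [MulAut.mul_apply])

/-- Underlying element of the restricted action (bookkeeping). [cite: Mochizuki2012, Prop 3.4 (i) p.91] -/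
@[simp] theorem coe_conjRestrict_apply (S : Submonoid E.H) (hS : E.IsConjStable S) (g : P) (x : S) :
    (E.conjRestrict S hS g x : E.H) = E.conj g x := rfl

/-- `M^×_TM` is conjugation-stable as soon as `M_TM` is (it is the group of units of `M_TM`, `units_eq`);
used for the pair `G_v ↷ Ψ^×_env = M^×_TM` of the second display. [cite: Mochizuki2012, Prop 3.4 (i) p.91] -/
theorem isConjStable_units (h : E.IsConjStable E.constantMonoid) : E.IsConjStable E.units.toSubmonoid := by
  intro g x hx
  rw [Subgroup.mem_toSubmonoid, E.units_eq] at hx ⊢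
  exact ⟨h g x hx.1, by rw [← map_inv]; exact h g x⁻¹ hx.2⟩

/-- The action of a quotient `Π_X(M^Θ_*) ↠ Π_X(M^Θ_*)/Δ` on a stable submonoid on which `Δ` acts trivially —
the shape of the pair `G_v(M^Θ_*(Π_v)) ↷ Ψ_env(M^Θ_*(Π_v))^×` of the second display of Prop 3.4 (i) ("the
notation `G_v(−)` is as in Proposition 3.1, (ii)": the quotient of `Π_X` corresponding to `Π_v ↠ G_v`).
[cite: Mochizuki2012, Prop 3.4 (i) p.91] -/
def conjQuot (S : Submonoid E.H) (hS : E.IsConjStable S) (Δ : Subgroup P) [Δ.Normal]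
    (hΔ : ∀ d ∈ Δ, ∀ x ∈ S, E.conj d x = x) : P ⧸ Δ →* MulAut S :=
  QuotientGroup.lift Δ (E.conjRestrict S hS) fun d hd =>
    MulEquiv.ext fun x => Subtype.ext (by simpa using hΔ d hd x x.2)

/-- The quotient action is the conjugation action on representatives (bookkeeping).
[cite: Mochizuki2012, Prop 3.4 (i) p.91] -/
@[simp] theorem conjQuot_mk (S : Submonoid E.H) (hS : E.IsConjStable S) (Δ : Subgroup P) [Δ.Normal]
    (hΔ : ∀ d ∈ Δ, ∀ x ∈ S, E.conj d x = x) (g : P) :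
    E.conjQuot S hS Δ hΔ (QuotientGroup.mk g) = E.conjRestrict S hS g := rfl

end Action

/-! ### 3. The output pairs of the functorial algorithm of Prop 3.4 as Galois–monoid pairs -/

section Pairs

variable (E : ThetaEnvData.{u, u} P) [TopologicalSpace P] [IsTopologicalGroup P]

/-- A stable submonoid `S` of the ambient module together with the (restricted) conjugation action of the
topological group `Π = Π_X(M^Θ_*(Π_v))`, packaged as a Galois–monoid pair `Π ↷ S` in the sense of [AbsTopIII]
Def 3.1 (ii) (`GaloisMonoidPair`: "the underlying pair, consisting of an ind-topological monoid equipped with the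
action of a topological group", Prop 3.4 (i) p. 92 l. 1–4), GIVEN that the point stabilisers are open (continuity
of the action: a hypothesis — the value-level record `ThetaEnvData` carries no topology).
[cite: Mochizuki2012, Prop 3.4 (i) p.91] -/
def pairOf (S : Submonoid E.H) (hS : E.IsConjStable S) (hopen : ∀ x : S, IsOpen {g : P | E.conj g x = x}) :
    GaloisMonoidPair.{u} :=
  { Pi := P
    M := S
    instAction := MulDistribMulAction.compHom S (E.conjRestrict S hS)
    isOpen_stabilizer := fun x => by
      convert hopen x using 1
      ext g
      simp only [SetLike.mem_coe, MulAction.mem_stabilizer_iff, Set.mem_setOf_eq]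
      exact ⟨fun h => congrArg Subtype.val h, fun h => Subtype.ext h⟩ }

/-- The underlying group of `pairOf` is `Π` (bookkeeping). [cite: Mochizuki2012, Prop 3.4 (i) p.91] -/
theorem pairOf_Pi (S : Submonoid E.H) (hS : E.IsConjStable S) (hopen : ∀ x : S, IsOpen {g : P | E.conj g x = x}) :
    (E.pairOf S hS hopen).Pi = P := rfl

/-- The underlying monoid of `pairOf` is `S` (bookkeeping). [cite: Mochizuki2012, Prop 3.4 (i) p.91] -/
theorem pairOf_M (S : Submonoid E.H) (hS : E.IsConjStable S) (hopen : ∀ x : S, IsOpen {g : P | E.conj g x = x}) :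
    (E.pairOf S hS hopen).M = S := rfl

/-- The action in `pairOf` is conjugation (bookkeeping). [cite: Mochizuki2012, Prop 3.4 (i) p.91] -/
theorem pairOf_smul (S : Submonoid E.H) (hS : E.IsConjStable S) (hopen : ∀ x : S, IsOpen {g : P | E.conj g x = x})
    (g : (E.pairOf S hS hopen).Pi) (x : (E.pairOf S hS hopen).M) :
    ((show S from g • x) : E.H) = E.conj (show P from g) (show S from x) := rfl

/-- **Output of the functorial algorithm of Prop 3.4 (i)** (first display, p. 91): the pair
`Π_X(M^Θ_*(Π_v)) ↷ Ψ^ι_env(M^Θ_*(Π_v))` — the split theta monoid labelled `ι` with its conjugation action — as a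
Galois–monoid pair. Hypotheses: `Ψ^ι_env` is conjugation-stable (in print the action permutes the `ι`'s,
`Prop31Statements.conj_permutes`; the pair at a fixed `ι` uses the stabiliser picture) and point stabilisers are
open. [cite: Mochizuki2012, Prop 3.4 (i) p.91] -/
def splitThetaPair (ι : E.Iota) (hS : E.IsConjStable (E.thetaMonoid ι))
    (hopen : ∀ x : E.thetaMonoid ι, IsOpen {g : P | E.conj g x = x}) : GaloisMonoidPair.{u} :=
  E.pairOf (E.thetaMonoid ι) hS hopen

/-- **Output of the functorial algorithm of Prop 3.4 (i)**, `∞`-version (first display, p. 91): the pair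
`Π_X(M^Θ_*(Π_v)) ↷ ∞Ψ^ι_env(M^Θ_*(Π_v))`. [cite: Mochizuki2012, Prop 3.4 (i) p.91] -/
def inftySplitThetaPair (ι : E.Iota) (hS : E.IsConjStable (E.inftyThetaMonoid ι))
    (hopen : ∀ x : E.inftyThetaMonoid ι, IsOpen {g : P | E.conj g x = x}) : GaloisMonoidPair.{u} :=
  E.pairOf (E.inftyThetaMonoid ι) hS hopen

/-- **Output of the functorial algorithm of Prop 3.4 (ii)** (first display, p. 92): the pair
`Π_X(M^Θ_*(Π_v)) ↷ Ψ_cns(M^Θ_*(Π_v))` — the constant monoid with its conjugation action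
(`Prop31Statements.constants_stable`). [cite: Mochizuki2012, Prop 3.4 (ii) p.92] -/
def constantPair (hS : E.IsConjStable E.constantMonoid)
    (hopen : ∀ x : E.constantMonoid, IsOpen {g : P | E.conj g x = x}) : GaloisMonoidPair.{u} :=
  E.pairOf E.constantMonoid hS hopen

/-- **Second display of Prop 3.4 (i)/(ii)** (pp. 91–92) at the level of `Π_X`: the pair `Π_X(M^Θ_*) ↷ Ψ^×_env =
Ψ^×_cns = M^×_TM` (the submonoid of units, "the superscript `×` denotes the submonoid of units"; the printed pair
is its quotient by the subgroup acting trivially, `conjQuot`). [cite: Mochizuki2012, Prop 3.4 (i) p.91] -/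
def unitsPair (hS : E.IsConjStable E.constantMonoid)
    (hopen : ∀ x : E.units.toSubmonoid, IsOpen {g : P | E.conj g x = x}) : GaloisMonoidPair.{u} :=
  E.pairOf E.units.toSubmonoid (E.isConjStable_units hS) hopen

end Pairs

/-! ### 4. Functoriality of the output pairs (the left-hand squares as isomorphisms of pairs) -/

namespace Iso

variable {E : ThetaEnvData.{u, u} P} {E' : ThetaEnvData.{u, u} P'} [TopologicalSpace P] [IsTopologicalGroup P]
  [TopologicalSpace P'] [IsTopologicalGroup P']

/-- An isomorphism of theta-environment data whose group isomorphism `φ` is a homeomorphism induces an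
isomorphism of Galois–monoid pairs `(Π ↷ S) ⥲ (Π' ↷ e(S))` ("induces compatible collections of isomorphisms …
where the upper horizontal isomorphisms … are isomorphisms of topological groups; the lower/middle horizontal
isomorphisms … are isomorphisms of monoids", Prop 3.4 (i) p. 91), PROVED compatibility with the actions.
[cite: Mochizuki2012, Prop 3.4 (i) p.91] -/
def pairIso (I : Iso E E') (ψ : P ≃ₜ* P') (hψ : ∀ g, ψ g = I.phi g) (S : Submonoid E.H) (hS : E.IsConjStable S)
    (hopen : ∀ x : S, IsOpen {g : P | E.conj g x = x}) (S' : Submonoid E'.H) (hS' : E'.IsConjStable S')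
    (hopen' : ∀ y : S', IsOpen {g' : P' | E'.conj g' y = y}) (h : S.map I.e = S') :
    GaloisMonoidPair.Iso (E.pairOf S hS hopen) (E'.pairOf S' hS' hopen') where
  isoPi := ψ
  isoM := I.restrict S S' h
  smul_comm g x := Subtype.ext (by
    show I.e (E.conj g (show S from x)) = E'.conj (ψ g) (I.e (show S from x))
    rw [hψ, I.map_conj])

/-- **Prop 3.4 (i), first display, as an isomorphism of pairs** (p. 91):
`(Π_X(M^Θ_*(Π_v)) ↷ Ψ^ι_env) ⥲ (Π_X(M^Θ_*(†F_v)) ↷ Ψ^{ι'}_env)`. [cite: Mochizuki2012, Prop 3.4 (i) p.91] -/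
def splitThetaPairIso (I : Iso E E') (ψ : P ≃ₜ* P') (hψ : ∀ g, ψ g = I.phi g) (ι : E.Iota)
    (hS : E.IsConjStable (E.thetaMonoid ι)) (hopen : ∀ x : E.thetaMonoid ι, IsOpen {g : P | E.conj g x = x})
    (hS' : E'.IsConjStable (E'.thetaMonoid (I.iota ι)))
    (hopen' : ∀ y : E'.thetaMonoid (I.iota ι), IsOpen {g' : P' | E'.conj g' y = y}) :
    GaloisMonoidPair.Iso (E.splitThetaPair ι hS hopen) (E'.splitThetaPair (I.iota ι) hS' hopen') :=
  I.pairIso ψ hψ _ hS hopen _ hS' hopen' (I.map_thetaMonoid ι)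

/-- **Prop 3.4 (i), first display, `∞`-row, as an isomorphism of pairs** (p. 91).
[cite: Mochizuki2012, Prop 3.4 (i) p.91] -/
def inftySplitThetaPairIso (I : Iso E E') (ψ : P ≃ₜ* P') (hψ : ∀ g, ψ g = I.phi g) (ι : E.Iota)
    (hS : E.IsConjStable (E.inftyThetaMonoid ι))
    (hopen : ∀ x : E.inftyThetaMonoid ι, IsOpen {g : P | E.conj g x = x})
    (hS' : E'.IsConjStable (E'.inftyThetaMonoid (I.iota ι)))
    (hopen' : ∀ y : E'.inftyThetaMonoid (I.iota ι), IsOpen {g' : P' | E'.conj g' y = y}) :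
    GaloisMonoidPair.Iso (E.inftySplitThetaPair ι hS hopen) (E'.inftySplitThetaPair (I.iota ι) hS' hopen') :=
  I.pairIso ψ hψ _ hS hopen _ hS' hopen' (I.map_inftyThetaMonoid ι)

/-- **Prop 3.4 (ii), first display, as an isomorphism of pairs** (p. 92):
`(Π_X(M^Θ_*(Π_v)) ↷ Ψ_cns) ⥲ (Π_X(M^Θ_*(†F_v)) ↷ Ψ_cns)`. [cite: Mochizuki2012, Prop 3.4 (ii) p.92] -/
def constantPairIso (I : Iso E E') (ψ : P ≃ₜ* P') (hψ : ∀ g, ψ g = I.phi g)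
    (hS : E.IsConjStable E.constantMonoid) (hopen : ∀ x : E.constantMonoid, IsOpen {g : P | E.conj g x = x})
    (hS' : E'.IsConjStable E'.constantMonoid)
    (hopen' : ∀ y : E'.constantMonoid, IsOpen {g' : P' | E'.conj g' y = y}) :
    GaloisMonoidPair.Iso (E.constantPair hS hopen) (E'.constantPair hS' hopen') :=
  I.pairIso ψ hψ _ hS hopen _ hS' hopen' I.map_constantMonoid

/-- **Prop 3.4 (i)/(ii), second display, as an isomorphism of pairs** (pp. 91–92) at the level of `Π_X`:
`(Π_X(M^Θ_*(Π_v)) ↷ M^×_TM) ⥲ (Π_X(M^Θ_*(†F_v)) ↷ M^×_TM)`. [cite: Mochizuki2012, Prop 3.4 (i) p.91] -/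
def unitsPairIso (I : Iso E E') (ψ : P ≃ₜ* P') (hψ : ∀ g, ψ g = I.phi g)
    (hS : E.IsConjStable E.constantMonoid) (hopen : ∀ x : E.units.toSubmonoid, IsOpen {g : P | E.conj g x = x})
    (hS' : E'.IsConjStable E'.constantMonoid)
    (hopen' : ∀ y : E'.units.toSubmonoid, IsOpen {g' : P' | E'.conj g' y = y}) :
    GaloisMonoidPair.Iso (E.unitsPair hS hopen) (E'.unitsPair hS' hopen') :=
  I.pairIso ψ hψ _ _ hopen _ _ hopen' I.map_units_toSubmonoid

end Iso

end ThetaEnvData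
end TemperedThetaMonoids
end Literature.IUT.HodgeArakelov
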